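import Summits.Ventures.AbcSig.Recipes.EisPackage
import Summits.Ventures.AbcSig.Levels.N53

/-!
# Venture AbcSig — GENERATED module-M6 DISCHARGE certificates, level 53

HONEST FRAMING. Machine-generated by the p-lean seat's `gen/m6xgen.py` (untrusted transcription + witness search): data
from engine-1's Sturm-complete level file `N53.engine1.json` (sha256 `8757b81f36b025e8bdea8e56637a116856abfedaace5163dd5c5cbc3008583e7`) re-expressed in the basis of the tree's
sieve data (`Levels/N53.lean`, summary `N53.json`), primes `(n, θ − r)` and Eisenstein combinations from
the cell's referee-verified M6 certificates named below. The KERNEL checks (`M6Cert.check … = true`): the Eisenstein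
congruence `a_m(f) ≡ a_m(G_λ)` for all `m ≤ B`, `6B ≥ ψ(53) = 54`; the identity `F = (X − r)·H + n·Q`; and an ordinary
sieve certificate for the data with `F` replaced by `H`. THEOREM per orbit: `M.ExcludesStd 53 orbit n` from the CITED
named hypothesis `NewformModel.EisPackage` ([BS04 (3.1), L4.2, Cor 3.1] + [Sturm 1987]) and the COMPUTED hypothesis
`NewformModel.Refines` (the extended coefficients belong to the same orbit and generator — backed by the engine file like
`DataComplete`). No claim on ABC or any summit; no Diophantine statement is made in this file.
-/

namespace Summit.Ventures.AbcSig


/-- Extended data of the tree orbit `orbit_53_2` (engine-1 id `53.2`): the same `F` and generator, entries `(p, d_p, g_p)` for EVERY prime `p ≤ 9` (`U_p`-eigenvalues from `a_bad` at `p ∣ 53`). -/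
def m6X_53_2 : OrbitData :=
  { F := [1, -1, -3, 1], coeffs := [⟨2, 1, [-1, -3, 1]⟩, ⟨3, 1, [0, 1]⟩, ⟨5, 1, [1, 2, -1]⟩, ⟨7, 1, [3, 2, -1]⟩] }

/-- M6 discharge certificate for `orbit_53_2` at `𝔫 = (13, θ − 4)` (the census certificate `M6_N53_53.2_n13_t3.json`, sha256 `76622d378bb7a43a…`, has `r = 3` in its own basis): Eisenstein part (λ = [(53, 7)], B = 9, ψ(53) = 54), splitting `F = (X − 4)·H + 13·Q`, and the relative sieve certificate for `{F := H}` (bases [3, 5], so every prime above 13 other than `𝔫` is sieved). -/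
def m6c_53_2_n13 : M6Cert :=
  { X := m6X_53_2,
    E := { n := 13, r := 4, dinv := [(2, 1), (3, 1), (5, 1), (7, 1)], lam := [(53, 7)], B := 9, facN := [(53, 1)], facs := [[], [(2, 1)], [(3, 1)], [(2, 2)], [(5, 1)], [(2, 1), (3, 1)], [(7, 1)], [(2, 3)], [(3, 2)]] },
    H := [3, 1, 1], Q := [1],
    certH := { fuel := 6, trees := [.split 0 [(-4, .leaf [[1], [3, -1]] 15), (-2, .leaf [[1], [1, -1]] 5), (0, .leaf [[1], [-1, -1]] 3), (2, .leaf [[1], [-3, -1]] 9), (4, .leaf [[1], [-5, -1]] 23)], .split 2 [(-8, .leaf [[20, -3], [11, -3]] 181), (-4, .leaf [[16, -3], [7, -3]] 97), (-2, .leaf [[14, -3], [5, -3]] 67), (0, .leaf [[4, -1], [1, -1]] 15), (2, .leaf [[10, -3], [1, -3]] 31), (4, .leaf [[8, -3], [-1, -3]] 25), (8, .leaf [[4, -3], [-5, -3]] 37)]], zs := [-11685428558, 461], fac := [(3, 1), (5, 2)] } }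
/-- Kernel check of `m6c_53_2_n13` against `orbit_53_2`. -/
theorem m6c_53_2_n13_check : m6c_53_2_n13.check 53 orbit_53_2 = true := by
  decide +kernel
/-- **`orbit_53_2` does not give rise to the mod-13 representation of any standing datum** (module M6 in the kernel), modulo the CITED `EisPackage` and the COMPUTED `Refines 53 orbit_53_2 m6X_53_2`. -/
theorem m6c_53_2_n13_excludes (M : NewformModel) (hE : M.EisPackage) (hRef : M.Refines 53 orbit_53_2 m6X_53_2) :
    M.ExcludesStd 53 orbit_53_2 13 :=
  M.excludesStd_of_m6 hE orbit_53_2 m6c_53_2_n13 (level53_wellformed orbit_53_2 (by simp [level53Orbits])) hRef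
    m6c_53_2_n13_check

end Summit.Ventures.AbcSig
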